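/-
Copyright (c) 2026. All rights reserved.
Released under Apache 2.0 license as described in the file LICENSE.
Authors: abc-iut cell, seat abc-iut-w5-d226 (gen 3; [AbsTopII] Prop 1.3 (iii) input «I_v ↠ I» for constructed
DPSC-extensions, answering L4-lead RULING #6a's question on row I-surj).
-/
import Literature.AnabelianGeometry.AbsoluteAnabelian.AbsTopII.DPSCDataOfOuterAction
import HarnessLib

/-!
# [AbsTopII] Prop 1.3 (iii) «I_v ↠ I» for the constructed DPSC-extension `Π_𝒢 ⋊^out H`

S. Mochizuki, *Topics in Absolute Anabelian Geometry II* [AbsTopII] (bib `MochizukiAbsTopII2013`), §1 Def 1.2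
(ii) p. 10 (`I_v := Z_{Π_I}(Π_v)`), Prop 1.3 (iii) p. 11 and its proof p. 13: "we obtain a natural injection
`I_v ↪ I`.  The fact that this injection is, in fact, surjective is immediate from the definitions when `X` is
smooth over `k` and follows from the computation of `I_v` performed in the proof of assertion (ii) when `X`
is singular" — i.e. it rests on HOW the inertia subgroup `I ⊆ H` acts on `Π_𝒢`: trivially on the
fundamental group `Π_v` of each irreducible component (the component is a smooth log curve over the log point).

abc-iut-L4's bridge carries this as the NAMED input `hsurj : X.Iv v ⊔ X.PiG = X.PiI` (row P13/I-surj of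
`plan/L4/SUBDAG-AbsTopII-Prop13.md`; not derivable from the `Π_𝒢`-level PSC presentation).  For the
CONSTRUCTED extension `DPSCData.ofOuterAction G hG θ I` (`Π_H := Π_𝒢 ⋊^out_θ J`, abc-iut-w5-d151's
`outerSemidirectProfinite`) this PROOF-ONLY file derives it from the outer action itself:

* `exists_conjAutOf_eq_of_lift` — if `φ` lifts the outer class `θ (snd h)`, conjugation by `h` on `Π_𝒢` is
  `x ↦ φ (p x p⁻¹)` for some `p ∈ Π_𝒢`;
* `Iv_sup_PiG_eq_PiI_ofOuterAction` — **«I_v ↠ I» holds as soon as every `i ∈ I` has a lift of `θ i` fixing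
  `Π_v` pointwise** ("inertia acts trivially on `Π_v` up to inner automorphisms" — the kernel form of the
  printed reason);
* `exists_fixing_lift_of_Iv_sup_PiG_eq_PiI`, `Iv_sup_PiG_eq_PiI_ofOuterAction_iff` — conversely (centre-free
  `Π_𝒢`) «I_v ↠ I» FORCES fixing lifts: for the constructed extension the printed input IS the statement
  "the inertia acts trivially on `Π_v` up to inner automorphisms";
* `prop13iii_ofOuterAction_of_fixing_lifts` — [AbsTopII] Prop 1.3 (iii), first clauses (F-0275), for the
  constructed extension from [CombGC] Prop 1.2 (ii) for `G`, slimness of `G`'s verticial subgroups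
  ([CombGC] Rmk 1.1.3) and fixing lifts of `θ|_I`.

HONEST FRAMING: classical group theory over the constructed object; the fixing-lift hypothesis is the typed
residue of the printed log-structure input, not a discharge of it; nothing here bears on [IUTchIII] Cor 3.12.
-/

noncomputable section

open scoped Pointwise

namespace Literature.AnabelianGeometry.AbsoluteAnabelian

open Literature.AlgebraicGeometry.Frobenioids (IsSlimGroup)
open Literature.AnabelianGeometry.EtaleTheta (contMulAut mem_contMulAut TopOut innerContAut)
open Literature.AnabelianGeometry.SemiGraphs
open Topology

universe u

namespace DPSCData

variable {P : Type u} [Group P] [TopologicalSpace P] [IsTopologicalGroup P] [CompactSpace P]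
  [TotallyDisconnectedSpace P] (G : PSCDatum P) (hG : IsTopologicallyFinitelyGenerated P)
  (hZ : Subgroup.center P = ⊥)
  {J : Type u} [Group J] [TopologicalSpace J] [IsTopologicalGroup J] [CompactSpace J]
  [TotallyDisconnectedSpace J] (θ : J →ₜ* outProfinite hG) (I : Subgroup J) [I.Normal]

/-- **Conjugation by `h ∈ Π_𝒢 ⋊^out J` on `Π_𝒢` in terms of ANY lift `φ` of `θ (snd h)`**: it is
`x ↦ φ (p x p⁻¹)` for some `p ∈ Π_𝒢` (the `Aut`-component of `h` and `φ` have the same outer class,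
`mk_autComponent`). [cite: MochizukiAbsTopII2013, Def 1.2 (ii) p.10] -/
theorem exists_conjAutOf_eq_of_lift (h : outerSemidirectProfinite hG θ) (φ : P ≃ₜ* P)
    (hφ : TopOut.mk P ⟨φ.toMulEquiv, (mem_contMulAut P).mpr ⟨φ.continuous, φ.symm.continuous⟩⟩ =
      outerActionOfContinuous hG θ h.1.2) :
    ∃ p : P, ∀ x, conjAutOf hG θ h x = φ (p * x * p⁻¹) := by
  set c : contMulAut P := ⟨φ.toMulEquiv, (mem_contMulAut P).mpr ⟨φ.continuous, φ.symm.continuous⟩⟩ with hc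
  have hclass : TopOut.mk P (autComponent hG θ h) = TopOut.mk P c := by rw [mk_autComponent, hφ]
  have hmem : c⁻¹ * autComponent hG θ h ∈ innerContAut P := by
    rw [← QuotientGroup.eq]
    exact hclass.symm
  obtain ⟨p, hp⟩ : ∃ p : P, MulAut.conj p = ((c⁻¹ * autComponent hG θ h : contMulAut P) : MulAut P) :=
    Subgroup.mem_subgroupOf.mp hmem
  have hmul : (c : MulAut P) * MulAut.conj p = (autComponent hG θ h : MulAut P) := by
    rw [hp, Subgroup.coe_mul, InvMemClass.coe_inv, mul_inv_cancel_left]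
  refine ⟨p, fun x => ?_⟩
  have hx := congrArg (fun ψ : MulAut P => ψ x) hmul
  simp only [MulAut.mul_apply, MulAut.conj_apply] at hx
  rw [conjAutOf_apply, ← hx]
  rfl

/-- **«I_v ↠ I» for the constructed DPSC-extension** ([AbsTopII] Prop 1.3 (iii) p. 13): if every `i ∈ I`
has a lift of the outer class `θ i` FIXING `Π_v` POINTWISE (the inertia acts trivially on the fundamental
group of the irreducible component, up to inner automorphisms), then `I_v · Π_𝔾 = Π_I` for the DPSC data
`ofOuterAction G hG θ I`. [cite: MochizukiAbsTopII2013, Prop 1.3 (iii) p.13] -/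
theorem Iv_sup_PiG_eq_PiI_ofOuterAction (v : (ofOuterAction G hG θ I).Vert)
    (hI : ∀ i ∈ I, ∃ φ : P ≃ₜ* P,
      TopOut.mk P ⟨φ.toMulEquiv, (mem_contMulAut P).mpr ⟨φ.continuous, φ.symm.continuous⟩⟩ =
          outerActionOfContinuous hG θ i ∧
        ∀ x ∈ G.vertGp v.down, φ x = x) :
    (ofOuterAction G hG θ I).Iv v ⊔ (ofOuterAction G hG θ I).PiG = (ofOuterAction G hG θ I).PiI := by
  apply le_antisymm
  · exact sup_le inf_le_right (ofOuterAction G hG θ I).PiG_le_PiI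
  rintro (h : outerSemidirectProfinite hG θ) hh
  -- `hh : snd h ∈ I`
  have hh' : h ∈ I.comap (sndProfinite hG θ).toMonoidHom := hh
  have hsnd : h.1.2 ∈ I := Subgroup.mem_comap.mp hh'
  obtain ⟨φ, hφ, hfix⟩ := hI _ hsnd
  obtain ⟨p, hp⟩ := exists_conjAutOf_eq_of_lift hG θ h φ hφ
  -- write `h = (h · inl p⁻¹) · inl p`; the first factor acts on `Π_𝒢` by `φ`, hence centralises `Π_v`
  have hconj : ∀ x : P, (h * (inlProfinite hG θ p)⁻¹) * inlProfinite hG θ x * (h * (inlProfinite hG θ p)⁻¹)⁻¹ =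
      inlProfinite hG θ (φ x) := by
    intro x
    have h1 : (h * (inlProfinite hG θ p)⁻¹) * inlProfinite hG θ x * (h * (inlProfinite hG θ p)⁻¹)⁻¹ =
        h * inlProfinite hG θ (p⁻¹ * x * p) * h⁻¹ := by
      simp only [map_mul, map_inv, mul_inv_rev, inv_inv, mul_assoc]
    have h2 : h * inlProfinite hG θ (p⁻¹ * x * p) * h⁻¹ = inlProfinite hG θ (conjAutOf hG θ h (p⁻¹ * x * p)) :=
      (inlProfinite_conjAutOf hG θ h _).symm
    have h3 : p * (p⁻¹ * x * p) * p⁻¹ = x := by group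
    rw [h1, h2, hp, h3]
  have hIv : h * (inlProfinite hG θ p)⁻¹ ∈ (ofOuterAction G hG θ I).Iv v := by
    refine Subgroup.mem_inf.mpr ⟨?_, ?_⟩
    · -- centralises `Π_v = inl(Π_{G,v})`
      refine Subgroup.mem_centralizer_iff.mpr ?_
      rintro y hy
      obtain ⟨x, hx, rfl⟩ : ∃ x ∈ G.vertGp v.down, (inlProfinite hG θ).toMonoidHom x = y := hy
      have key := hconj x
      rw [hfix x hx] at key
      -- `a * b * a⁻¹ = b` ⇒ `b * a = a * b`
      change inlProfinite hG θ x * (h * (inlProfinite hG θ p)⁻¹) =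
        (h * (inlProfinite hG θ p)⁻¹) * inlProfinite hG θ x
      exact (mul_inv_eq_iff_eq_mul.mp key).symm
    · -- lies in `Π_I`
      have hp' : (inlProfinite hG θ p)⁻¹ ∈ (ofOuterAction G hG θ I).PiI :=
        Subgroup.inv_mem _ ((ofOuterAction G hG θ I).PiG_le_PiI ⟨p, rfl⟩)
      exact Subgroup.mul_mem _ hh hp'
  have hG' : inlProfinite hG θ p ∈ (ofOuterAction G hG θ I).PiG := ⟨p, rfl⟩
  have hmem : h * (inlProfinite hG θ p)⁻¹ * inlProfinite hG θ p ∈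
      (ofOuterAction G hG θ I).Iv v ⊔ (ofOuterAction G hG θ I).PiG :=
    Subgroup.mul_mem _ (Subgroup.mem_sup_left hIv) (Subgroup.mem_sup_right hG')
  have heq : h * (inlProfinite hG θ p)⁻¹ * inlProfinite hG θ p = h := inv_mul_cancel_right h _
  rw [heq] at hmem
  exact hmem

include hZ in
/-- **Converse: «I_v ↠ I» forces fixing lifts** (for centre-free `Π_𝒢`): if `I_v · Π_𝔾 = Π_I` for the
constructed DPSC-extension, then every `i ∈ I` has a lift of `θ i` fixing `Π_v` pointwise — namely the
`Aut`-component of the `I_v`-part of any `h` over `i`.  So, for `Π_𝒢 ⋊^out_θ J`, the printed input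
«I_v ↠ I» IS the statement "the inertia acts trivially on `Π_v` up to inner automorphisms".
[cite: MochizukiAbsTopII2013, Prop 1.3 (iii) p.13] -/
theorem exists_fixing_lift_of_Iv_sup_PiG_eq_PiI (v : (ofOuterAction G hG θ I).Vert)
    (hsurj : (ofOuterAction G hG θ I).Iv v ⊔ (ofOuterAction G hG θ I).PiG = (ofOuterAction G hG θ I).PiI)
    (i : J) (hi : i ∈ I) :
    ∃ φ : P ≃ₜ* P,
      TopOut.mk P ⟨φ.toMulEquiv, (mem_contMulAut P).mpr ⟨φ.continuous, φ.symm.continuous⟩⟩ =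
          outerActionOfContinuous hG θ i ∧
        ∀ x ∈ G.vertGp v.down, φ x = x := by
  obtain ⟨h₀, hh⟩ := sndProfinite_surjective hG θ i
  -- view `h₀` as an element of the `Π_H` of the DPSC data (same type up to unfolding; keeps the lattice of
  -- subgroups of `Π_H` syntactically uniform for `Subgroup.mem_sup`)
  obtain ⟨h, rfl⟩ : ∃ h : (ofOuterAction G hG θ I).PiH, h = h₀ := ⟨h₀, rfl⟩
  have hI' : h ∈ I.comap (sndProfinite hG θ).toMonoidHom := by
    refine Subgroup.mem_comap.mpr ?_
    rw [← hh] at hi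
    exact hi
  have hPiI : h ∈ (ofOuterAction G hG θ I).Iv v ⊔ (ofOuterAction G hG θ I).PiG := by
    rw [hsurj]
    exact hI'
  haveI : (ofOuterAction G hG θ I).PiG.Normal := (ofOuterAction G hG θ I).normal_PiG
  obtain ⟨z, hz, g, hg, hzg⟩ := Subgroup.mem_sup_of_normal_right.mp hPiI
  obtain ⟨p, rfl⟩ := hg
  -- view `z` in `Π_𝒢 ⋊^out J`
  obtain ⟨w, rfl⟩ : ∃ w : outerSemidirectProfinite hG θ, w = z := ⟨z, rfl⟩
  -- `snd w = i`
  have hw2 : w.1.2 = i := by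
    have e' : w * inlProfinite hG θ p = h := hzg
    have e : w.1.2 * (inlProfinite hG θ p).1.2 = i := by
      have e'' : (w * inlProfinite hG θ p).1.2 = i := by
        rw [e']
        exact hh
      exact e''
    have e3 : (inlProfinite hG θ p).1.2 = 1 := rfl
    rw [e3, mul_one] at e
    exact e
  refine ⟨conjAutOf hG θ w, ?_, fun x hx => ?_⟩
  · have hc : (⟨(conjAutOf hG θ w).toMulEquiv, (mem_contMulAut P).mpr
        ⟨(conjAutOf hG θ w).continuous, (conjAutOf hG θ w).symm.continuous⟩⟩ : contMulAut P) =
        autComponent hG θ w := Subtype.ext rfl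
    rw [hc, mk_autComponent, hw2]
  · apply inlProfinite_injective hG θ hZ
    have hzc := (Subgroup.mem_inf.mp hz).1
    have hcomm : inlProfinite hG θ x * w = w * inlProfinite hG θ x :=
      Subgroup.mem_centralizer_iff.mp hzc _ ⟨x, hx, rfl⟩
    exact (inlProfinite_conjAutOf hG θ w x).trans (mul_inv_eq_iff_eq_mul.mpr hcomm.symm)

include hZ in
/-- **«I_v ↠ I» ⟺ fixing lifts of `θ|_I`** for the constructed DPSC-extension over a centre-free `Π_𝒢`.
[cite: MochizukiAbsTopII2013, Prop 1.3 (iii) p.13] -/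
theorem Iv_sup_PiG_eq_PiI_ofOuterAction_iff (v : (ofOuterAction G hG θ I).Vert) :
    (ofOuterAction G hG θ I).Iv v ⊔ (ofOuterAction G hG θ I).PiG = (ofOuterAction G hG θ I).PiI ↔
      ∀ i ∈ I, ∃ φ : P ≃ₜ* P,
        TopOut.mk P ⟨φ.toMulEquiv, (mem_contMulAut P).mpr ⟨φ.continuous, φ.symm.continuous⟩⟩ =
            outerActionOfContinuous hG θ i ∧
          ∀ x ∈ G.vertGp v.down, φ x = x :=
  ⟨fun h => exists_fixing_lift_of_Iv_sup_PiG_eq_PiI G hG hZ θ I v h,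
    Iv_sup_PiG_eq_PiI_ofOuterAction G hG θ I v⟩

include hZ in
/-- **[AbsTopII] Prop 1.3 (iii), first clauses, AS TYPED (F-0275) for `Π_𝒢 ⋊^out_θ J` from [CombGC]
Prop 1.2 (ii) for `G`, slimness of `G`'s verticial subgroups ([CombGC] Rmk 1.1.3 — named) and FIXING LIFTS
of `θ|_I`** (the inertia acts trivially on each `Π_v` up to inner automorphisms).
[cite: MochizukiAbsTopII2013, Prop 1.3 (iii) p.11] [cite: MochizukiCombGC2007, Prop 1.2 p.8] -/
theorem prop13iii_ofOuterAction_of_fixing_lifts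
    (hCT : G.VerticialEdgeLikeCommensurablyTerminal) (hslimv : ∀ w, IsSlimGroup ↥(G.vertGp w))
    (hI : ∀ (w : G.graph.V) (i : J), i ∈ I → ∃ φ : P ≃ₜ* P,
      TopOut.mk P ⟨φ.toMulEquiv, (mem_contMulAut P).mpr ⟨φ.continuous, φ.symm.continuous⟩⟩ =
          outerActionOfContinuous hG θ i ∧
        ∀ x ∈ G.vertGp w, φ x = x) :
    (ofOuterAction G hG θ I).Prop13iii :=
  prop13iii_ofOuterAction G hG hZ θ I hCT hslimv
    (fun v => Iv_sup_PiG_eq_PiI_ofOuterAction G hG θ I v (fun i hi => hI v.down i hi))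

end DPSCData

end Literature.AnabelianGeometry.AbsoluteAnabelian

end
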